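import Summits.QuantumFields.BalabanUV.Beta.GAN24.ArrowOperator
import Summits.QuantumFields.BalabanUV.Beta.GAN24.ArrowNorms

/-!
# `BalabanUV.Beta.GAN24.ArrowSchurEntries` — binder row G-an2-4 / (CONV-C), road P1-fibre, p1 row **P1-L10** `FibreStrip` ((I3′)), leaf-16's cut (M4)
# `L10-CUT-M4.md` row **F5 `ArrowAnchorReal`**, PREP PART (iv): THE ENTRIES OF F1b's REDUCED BORDER SYSTEM FOR SLOT-DIAGONAL BORDERS

NOT IN PRINT; OUR PROOF ATTEMPT.  HONEST FRAMING (cell contract, verbatim): «discharging `BetaPertH` makes Bałaban's UV stability UNCONDITIONAL — a real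
constructive-QFT result; it is NOT the continuum limit and NOT the Clay problem.»  HONEST DEPENDENCY (verbatim): «continuum YM on T⁴ ⇐ BetaPertH ∧ nine spine
estimates (0/9 proved); BetaPertH ⇐ (D1) ∧ (D4) ∧ CAP+tail; G-an2-4 gates asym, D1 and NE2/3/4.»  [folklore] finite-sum algebra over F1a `ArrowOperator` (leaf-16:
`arrowMat`, `borU`, `borV`, `locW`, `borW`) and F1b `ArrowNorms` (`colBorder`, `rowBorder`, `capS`) — every input BY NAME; no cited fact, no wall binder, no `def`,
no `def … : Prop`.  NOT summit progress: nothing of (CONV-C)'s K-slot `GAN24.CombesThomas.ConvCK 3 Lc` is discharged here; 0 wall binders; NOT `BetaPertH`, NOT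
continuum, NOT Clay.

## What is proved (generic block label `o`, slot type `l`, block data `T : o → Matrix l l ℂ`, border weight functions `f g : o → l → ℂ`)
* `rowBorder_mul_apply`, `mul_colBorder_apply` (a slot-diagonal border collapses the slot sum);
* **`capS_apply`**: `ArrowNorms.capS T (colBorder f) (rowBorder g) s s' = Σ_m g m s · (T m)⁻¹ s s' · f m s'` — the reduced border system of an arrow-shaped
  matrix with SLOT-DIAGONAL borders is the alias sum of `(row weight)·(block inverse entry)·(column weight)`;
* the ARROW instance: `borU X = colBorder (negLocW X)`, `borV X = rowBorder X.borW` (`rfl`), hence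
  **`capS_arrow_apply`**: `capS X.T (borU X) (borV X) s s' = −Σ_m X.borW m s · (X.T m)⁻¹ s s' · X.locW m s'`, with the four `Loc D`-block cases spelled out
  (`wQ·(T⁻¹)_{AA}·wE`, `wQ·(T⁻¹)_{Aμ}·wG`, `wM·(T⁻¹)_{μA}·wE`, `wM·(T⁻¹)_{μμ}·wG`).
Consumer: F5 proper — with F1c's explicit unit-block inverse `[[ (1 − uuᴴ)/2, u ],[ −uᴴ, 0 ]]` these sums are `−capP`, `−capV`, `+capW`, `0` of T00's `cap` times the
outer scalings, i.e. `capS (outer) = diag(−1_φ, +1_c)·capSR N q (radO N q 0)` (`ArrowAnchorRealCapRadius`).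
Unit `b2b-balaban-gan24-formalise-leaf-12` (G-an2-4 formalisation swarm, leaf prover 12, gen 7), 2026-08-20.
-/

noncomputable section

open Matrix Finset
open scoped BigOperators

namespace Summit.QuantumFields.BalabanUV.Beta.GAN24.ArrowSchurEntries

open ArrowNorms (colBorder rowBorder capS)
open ArrowOperator (Loc ArrowData arrowMat borU borV negLocW)

/-! ## §1 Slot-diagonal borders collapse the slot sum -/

section Generic

variable {o l b : Type*}

/-- [folklore] `(rowBorder g · M) s j = Σ_m g m s · M (s, m) j`. -/
theorem rowBorder_mul_apply [Fintype o] [Fintype l] [DecidableEq l] (g : o → l → ℂ) (M : Matrix (l × o) b ℂ) (s : l) (j : b) :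
    (rowBorder g * M) s j = ∑ m, g m s * M (s, m) j := by
  simp only [Matrix.mul_apply, rowBorder, of_apply, ite_mul, zero_mul]
  rw [Fintype.sum_prod_type, Finset.sum_comm]
  simp only [Finset.sum_ite_eq, Finset.mem_univ, if_true]

/-- [folklore] `(M · colBorder f) i s' = Σ_m M i (s', m) · f m s'`. -/
theorem mul_colBorder_apply [Fintype o] [Fintype l] [DecidableEq l] (M : Matrix b (l × o) ℂ) (f : o → l → ℂ) (i : b) (s' : l) :
    (M * colBorder f) i s' = ∑ m, M i (s', m) * f m s' := by
  simp only [Matrix.mul_apply, colBorder, of_apply, mul_ite, mul_zero]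
  rw [Fintype.sum_prod_type, Finset.sum_comm]
  simp only [Finset.sum_ite_eq', Finset.mem_univ, if_true]

/-- [folklore] Entries of a block-diagonal matrix on the diagonal slot pattern: `blockDiagonal M (s, m) (s', m') = if m = m' then M m s s' else 0`. -/
theorem blockDiagonal_entry [DecidableEq o] (M : o → Matrix l l ℂ) (s s' : l) (m m' : o) :
    blockDiagonal M (s, m) (s', m') = if m = m' then M m s s' else 0 :=
  blockDiagonal_apply' M s m s' m'

/-- **THE REDUCED BORDER SYSTEM, ENTRYWISE** [folklore]: for slot-diagonal borders,
`capS T (colBorder f) (rowBorder g) s s' = Σ_m g m s · (T m)⁻¹ s s' · f m s'`. -/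
theorem capS_apply [Fintype o] [DecidableEq o] [Fintype l] [DecidableEq l] (T : o → Matrix l l ℂ) (f g : o → l → ℂ) (s s' : l) :
    capS T (colBorder f) (rowBorder g) s s' = ∑ m, g m s * (T m)⁻¹ s s' * f m s' := by
  unfold capS
  rw [mul_colBorder_apply]
  refine Finset.sum_congr rfl fun m _ => ?_
  rw [rowBorder_mul_apply]
  have h : ∑ m' : o, g m' s * blockDiagonal (fun k => (T k)⁻¹) (s, m') (s', m) = g m s * (T m)⁻¹ s s' := by
    simp only [blockDiagonal_entry, mul_ite, mul_zero, Finset.sum_ite_eq', Finset.mem_univ, if_true]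
  rw [h]

end Generic

/-! ## §2 The arrow instance -/

section Arrow

variable {D : ℕ} {ι : Type*}

/-- [folklore] The arrow matrix's column border IS `colBorder (negLocW X)`. -/
theorem borU_eq_colBorder (X : ArrowData D ι) : borU X = colBorder (negLocW X) := rfl

/-- [folklore] The arrow matrix's row border IS `rowBorder X.borW`. -/
theorem borV_eq_rowBorder (X : ArrowData D ι) : borV X = rowBorder X.borW := rfl

/-- [folklore] `arrowMat X = fromBlocks (blockDiagonal X.T) (colBorder (negLocW X)) (rowBorder X.borW) 0` — the shape F1b's `isUnit_bordered` speaks about. -/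
theorem arrowMat_eq [DecidableEq ι] (X : ArrowData D ι) :
    arrowMat X = fromBlocks (blockDiagonal X.T) (colBorder (negLocW X)) (rowBorder X.borW) 0 := rfl

/-- **THE REDUCED BORDER SYSTEM OF AN ARROW MATRIX, ENTRYWISE** [folklore]:
`capS X.T (borU X) (borV X) s s' = −Σ_m X.borW m s · (X.T m)⁻¹ s s' · X.locW m s'`. -/
theorem capS_arrow_apply [Fintype ι] [DecidableEq ι] (X : ArrowData D ι) (s s' : Loc D) :
    capS X.T (borU X) (borV X) s s' = -∑ m, X.borW m s * (X.T m)⁻¹ s s' * X.locW m s' := by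
  rw [borU_eq_colBorder, borV_eq_rowBorder, capS_apply, ← Finset.sum_neg_distrib]
  refine Finset.sum_congr rfl fun m _ => ?_
  simp only [negLocW]
  ring

/-- [folklore] The `(Q_κ, φ_l)` entry: `−Σ_m wQ m κ · (T m)⁻¹ (A_κ, A_l) · wE m l`. -/
theorem capS_arrow_inl_inl [Fintype ι] [DecidableEq ι] (X : ArrowData D ι) (κ l : Fin D) :
    capS X.T (borU X) (borV X) (Sum.inl κ) (Sum.inl l) = -∑ m, X.wQ m κ * (X.T m)⁻¹ (Sum.inl κ) (Sum.inl l) * X.wE m l := by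
  rw [capS_arrow_apply]; rfl

/-- [folklore] The `(Q_κ, c)` entry: `−Σ_m wQ m κ · (T m)⁻¹ (A_κ, μ) · wG m`. -/
theorem capS_arrow_inl_inr [Fintype ι] [DecidableEq ι] (X : ArrowData D ι) (κ : Fin D) (u : Unit) :
    capS X.T (borU X) (borV X) (Sum.inl κ) (Sum.inr u) = -∑ m, X.wQ m κ * (X.T m)⁻¹ (Sum.inl κ) (Sum.inr u) * X.wG m := by
  rw [capS_arrow_apply]; rfl

/-- [folklore] The `(M, φ_l)` entry: `−Σ_m wM m · (T m)⁻¹ (μ, A_l) · wE m l`. -/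
theorem capS_arrow_inr_inl [Fintype ι] [DecidableEq ι] (X : ArrowData D ι) (u : Unit) (l : Fin D) :
    capS X.T (borU X) (borV X) (Sum.inr u) (Sum.inl l) = -∑ m, X.wM m * (X.T m)⁻¹ (Sum.inr u) (Sum.inl l) * X.wE m l := by
  rw [capS_arrow_apply]; rfl

/-- [folklore] The `(M, c)` entry: `−Σ_m wM m · (T m)⁻¹ (μ, μ) · wG m`. -/
theorem capS_arrow_inr_inr [Fintype ι] [DecidableEq ι] (X : ArrowData D ι) (u u' : Unit) :
    capS X.T (borU X) (borV X) (Sum.inr u) (Sum.inr u') = -∑ m, X.wM m * (X.T m)⁻¹ (Sum.inr u) (Sum.inr u') * X.wG m := by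
  rw [capS_arrow_apply]; rfl

end Arrow

end Summit.QuantumFields.BalabanUV.Beta.GAN24.ArrowSchurEntries

end
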